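import Mathlib
import Literature.LinearAlgebra.Matrix.NilpotentSumTraceOrthogonality

/-!
# `GrenetZeon.DualUnipotentThreeHalves` (stmt-ValiantsHypothesis-24318), R2 `HeavyTopLaw` — towards ι(4) = 3 in the kernel:
# the GRADED-LIMIT LEMMA and the generic-type-(4) case (experiment cell «val-heavytop-census», engine seat val-htc-eng-1)

`ι(m)` is the maximal dimension of an IRREDUCIBLE linear space of nilpotent `m × m` complex matrices (Mathes–Omladič–Radjavi,
LAA 149 (1991) §5, open question).  `Cruxes/DualUnipotentThreeHalves/INSTANCES.md` §7 reduces `HeavyTopInst 4 6` to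
`ι(4) ≤ 3 ∧ ι(5) ≤ 7 ∧ ι(6) ≤ 11`.  The cell's hand proof `pub/val-heavytop-census/eng-1/NOTE-iota4.md` (lead replication PASS)
shows **ι(4) = 3**: every nilpotent subspace of `M₄(ℂ)` of dimension `≥ 4` is reducible.  This file is the kernel version of its
two load-bearing ingredients (the lead's split: port-3 g2 types the linear «tangent cut» (T1) and the two endings; this seat types
(T2) and the case analysis):

* §1 `pow_eq_zero_of_initialForms` (and `forms2`, `forms3`) — the **graded-limit lemma** in algebraic form: if every member of a
  linear space `V ≤ M_n(ℂ)` satisfies `M^p = 0`, `B_i ∈ V` has no entry of height `< h_i` (height of `(a,b)` is `b − a`), and `u_i` is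
  the height-`h_i` component of `B_i`, then `(Σ c_i u_i)^p = 0` for all scalars.  Proof: the polynomial matrix
  `P(X)_{ab} = Σ_i c_i (B_i)_{ab} X^{b−a−h_i}` evaluates at `t ≠ 0` to the torus conjugate `D(t)(Σ_i c_i t^{−h_i}B_i)D(t)⁻¹`,
  `D(t) = diag(t^{−a})`, of a member of `V`; so every entry of `P^p` has infinitely many roots, `P^p = 0`, and `P(0) = Σ c_i u_i`.
* §2 small `4 × 4` facts (diagonal of an upper-triangular matrix with `B⁴ = 0` vanishes, …).
* (companion file `…HeavyTopIotaFourTypeFour`) **`typeFour_row_or_col`** — generic type `(4)`: if `V ≤ M₄(ℂ)` has `A⁴ = 0` for all members, contains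
  `J = E₀₁+E₁₂+E₂₃`, lies in `T(J) = {B : B₃₀ = 0, B₂₀+B₃₁ = 0, B₁₀+B₂₁+B₃₂ = 0}` (port-3's (T1)), and `dim V ≥ 4`, then, in the same
  coordinates, EITHER every member has zero row `3` (invariant hyperplane `span{e₀,e₁,e₂}`) OR every member has zero column `0`
  (common kernel line `ℂe₀`).  Route (NOTE-iota4 §2, reorganised to avoid limits): (2a) `typeFour_ac`: the height-`−1` part `(a,b,c)`
  of a member without height-`−2` entry has `ac = 0` (forms `J`, `Y`: `(J+Y)⁴ = −ac·1`); if NO member has a height-`−2` entry the two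
  shapes `c = 0` / `a = 0` cannot coexist (their sum violates `ac = 0`) and give the two endings (an eigenvalue `B₃₃` resp. `B₀₀` of a
  nilpotent vanishes); if SOME member `B₀` has `(B₀)₂₀ = 1` then `dim V ≤ 3`: `typeFour_F1/F2/F3` (forms `E₂₀−E₃₁`, `J`, and the
  initial form of a strictly upper member) show that a strictly upper member is determined by `(N₀₁, N₁₂)` (and by `N₀₁` alone when
  some member has a non-zero height-`−1` part, via trace orthogonality ✓ `Literature…trace_mul_eq_zero_of_mem`), so an explicit
  linear map `V → ℂ³` is injective (`LinearMap.finrank_le_finrank_of_injective`).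

NOT here: §3 (companion file), the generic-type-(3,1) case and the assembly with (T1) into «dim ≥ 4 ⇒ reducible» (next file).  Honest framing: data for
the instrument; nothing here proves or refutes `HeavyTopLaw`, 24318, S3b or 8062; `VP ≠ VNP` is not moved.  No definitions, no named
facts (matrices are literals). [NOTE-iota4 (this seat); MOR 1991 §5 for the question]
-/

noncomputable section

-- single-conjunct layout: Sub = Summit, duplicated namespace component intended
set_option linter.dupNamespace false
set_option linter.unnecessarySeqFocus false

namespace Summit.ValiantsHypothesis.ValiantsHypothesis.Theorems.GrenetZeon.HeavyTopIotaFour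

open Matrix Polynomial

/-! ## §1 The graded-limit lemma (torus degeneration, algebraic form)

For the torus `D(t) = diag(t^{-a})` one has `(D(t) B D(t)⁻¹)_{ab} = t^{b-a} B_{ab}`: the entry `(a,b)` has HEIGHT `b - a`.
If `B₁,…,B_k` lie in a linear space `V` all of whose members satisfy `M^p = 0`, and `B_i` has no entry of height
`< h_i`, then every linear combination of the height-`h_i` components («initial forms») `u_i` of the `B_i` satisfies
`(Σ c_i u_i)^p = 0`: the polynomial matrix `P(X) = Σ_i c_i X^{b-a-h_i} (B_i)_{ab}` evaluates at `X = t ≠ 0` to a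
conjugate of the member `Σ c_i t^{-h_i} B_i` of `V`, so `P(t)^p = 0` for all `t ≠ 0`, hence `P^p = 0`, hence `P(0)^p = 0`. -/

/-- Conjugating by the torus and undoing it: `diag(t^{-a}) · diag(t^{a}) = 1` for `t ≠ 0`. -/
theorem torus_mul_torus_inv {n : ℕ} (t : ℂ) (ht : t ≠ 0) :
    (diagonal fun a : Fin n => t ^ (-(a : ℤ))) * (diagonal fun a : Fin n => t ^ ((a : ℤ))) = 1 := by
  rw [diagonal_mul_diagonal, ← diagonal_one]
  congr 1; funext a
  rw [← zpow_add₀ ht]; simp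

/-- Conjugating by the torus and undoing it (other order). -/
theorem torus_inv_mul_torus {n : ℕ} (t : ℂ) (ht : t ≠ 0) :
    (diagonal fun a : Fin n => t ^ ((a : ℤ))) * (diagonal fun a : Fin n => t ^ (-(a : ℤ))) = 1 := by
  rw [diagonal_mul_diagonal, ← diagonal_one]
  congr 1; funext a
  rw [← zpow_add₀ ht]; simp

/-- Powers of a torus conjugate: `(D M D')^p = D M^p D'` when `D' D = 1`. -/
theorem conj_pow {n : ℕ} (D D' M : Matrix (Fin n) (Fin n) ℂ) (hDD : D' * D = 1) (p : ℕ) :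
    (D * M * D') ^ p = D * M ^ p * D' ∨ p = 0 := by
  induction p with
  | zero => right; rfl
  | succ p ih =>
    left
    rcases ih with ih | ih
    · rw [pow_succ, ih, pow_succ]
      simp only [Matrix.mul_assoc]
      rw [← Matrix.mul_assoc D' D, hDD, Matrix.one_mul]
    · subst ih; simp

/-- **Graded-limit lemma.**  Let every member of the linear space `V ≤ M_n(ℂ)` satisfy `M^p = 0` (`p ≥ 1`).  Let `B_i ∈ V`
(`i < k`) have no entry of height `< h_i` (height of `(a,b)` is `b - a`).  Then for all scalars `c_i` the combination
of the height-`h_i` components `u_i = (B_i)_{b-a=h_i}` satisfies `(Σ_i c_i u_i)^p = 0`. [NOTE-iota4 (T2); this file] -/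
theorem pow_eq_zero_of_initialForms {n p k : ℕ} (hp : 1 ≤ p) (V : Submodule ℂ (Matrix (Fin n) (Fin n) ℂ))
    (hV : ∀ A ∈ V, A ^ p = 0) (B : Fin k → Matrix (Fin n) (Fin n) ℂ) (hB : ∀ i, B i ∈ V)
    (h : Fin k → ℤ) (hlow : ∀ i (a b : Fin n), (b : ℤ) - a < h i → B i a b = 0) (c : Fin k → ℂ) :
    (∑ i, c i • Matrix.of (fun a b : Fin n => if (b : ℤ) - a = h i then B i a b else 0)) ^ p = 0 := by
  classical
  -- the polynomial matrix
  let P : Matrix (Fin n) (Fin n) ℂ[X] :=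
    Matrix.of fun a b => ∑ i, Polynomial.C (c i * B i a b) * X ^ ((b : ℤ) - a - h i).toNat
  -- evaluation at t ≠ 0 is a torus conjugate of a member of V
  have heval : ∀ t : ℂ, t ≠ 0 →
      P.map (Polynomial.eval t) =
        (diagonal fun a : Fin n => t ^ (-(a : ℤ))) * (∑ i, (c i * t ^ (-(h i))) • B i) *
          (diagonal fun a : Fin n => t ^ ((a : ℤ))) := by
    intro t ht
    ext a b
    simp only [P, map_apply, of_apply, Polynomial.eval_finsetSum, Polynomial.eval_mul, Polynomial.eval_C,
      Polynomial.eval_pow, Polynomial.eval_X, diagonal_mul, mul_diagonal, Matrix.sum_apply,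
      Matrix.smul_apply, smul_eq_mul, Finset.mul_sum, Finset.sum_mul]
    refine Finset.sum_congr rfl fun i _ => ?_
    by_cases hz : B i a b = 0
    · simp [hz]
    · have hge : h i ≤ (b : ℤ) - a := by
        by_contra hlt; exact hz (hlow i a b (lt_of_not_ge hlt))
      have hnn : 0 ≤ (b : ℤ) - a - h i := by linarith
      have key : t ^ ((b : ℤ) - a - h i).toNat = t ^ (-(a : ℤ)) * t ^ (-(h i)) * t ^ ((b : ℤ)) := by
        rw [← zpow_natCast, Int.toNat_of_nonneg hnn, ← zpow_add₀ ht, ← zpow_add₀ ht]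
        congr 1; ring
      rw [key]; ring
  have hmem : ∀ t : ℂ, (∑ i, (c i * t ^ (-(h i))) • B i) ∈ V := by
    intro t
    exact V.sum_mem fun i _ => V.smul_mem _ (hB i)
  -- P(t)^p = 0 for t ≠ 0
  have hPt : ∀ t : ℂ, t ≠ 0 → (P ^ p).map (Polynomial.eval t) = 0 := by
    intro t ht
    have hm : (P ^ p).map (Polynomial.eval t) = (P.map (Polynomial.eval t)) ^ p := by
      change (Polynomial.evalRingHom t).mapMatrix (P ^ p) = ((Polynomial.evalRingHom t).mapMatrix P) ^ p
      exact map_pow _ _ _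
    rw [hm, heval t ht]
    rcases conj_pow (diagonal fun a : Fin n => t ^ (-(a : ℤ))) (diagonal fun a : Fin n => t ^ ((a : ℤ)))
        (∑ i, (c i * t ^ (-(h i))) • B i) (torus_inv_mul_torus t ht) p with hc | hc
    · rw [hc, hV _ (hmem t)]; simp
    · omega
  -- hence P^p = 0 (each entry has infinitely many roots)
  have hPp : P ^ p = 0 := by
    refine Matrix.ext fun a b => ?_
    have hroots : ∀ t : ℂ, t ≠ 0 → ((P ^ p) a b).IsRoot t := by
      intro t ht
      have := congr_fun (congr_fun (hPt t ht) a) b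
      simp only [Polynomial.IsRoot]; simpa using this
    apply Polynomial.eq_zero_of_infinite_isRoot
    apply Set.Infinite.mono (s := {t : ℂ | t ≠ 0})
    · intro t ht; exact hroots t ht
    · exact Set.infinite_of_finite_compl (by simp)
  -- evaluate at 0
  have h0 : (P.map (Polynomial.eval 0)) ^ p = 0 := by
    have hm : (P ^ p).map (Polynomial.eval 0) = (P.map (Polynomial.eval 0)) ^ p := by
      change (Polynomial.evalRingHom 0).mapMatrix (P ^ p) = ((Polynomial.evalRingHom 0).mapMatrix P) ^ p
      exact map_pow _ _ _
    rw [← hm, hPp]; simp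
  have hP0 : P.map (Polynomial.eval 0) =
      ∑ i, c i • Matrix.of (fun a b : Fin n => if (b : ℤ) - a = h i then B i a b else 0) := by
    ext a b
    simp only [P, map_apply, of_apply, Polynomial.eval_finsetSum, Polynomial.eval_mul, Polynomial.eval_C,
      Polynomial.eval_pow, Polynomial.eval_X, Matrix.sum_apply, Matrix.smul_apply, smul_eq_mul]
    refine Finset.sum_congr rfl fun i _ => ?_
    by_cases heq : (b : ℤ) - a = h i
    · simp [heq]
    · by_cases hz : B i a b = 0
      · simp [hz]
      · have hge : h i ≤ (b : ℤ) - a := by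
          by_contra hlt; exact hz (hlow i a b (lt_of_not_ge hlt))
        have hpos : 0 < ((b : ℤ) - a - h i).toNat := by
          have : 0 < (b : ℤ) - a - h i := by omega
          omega
        simp [heq, zero_pow hpos.ne']
  rw [← hP0]; exact h0


/-- Graded-limit lemma, two forms. -/
theorem forms2 {n p : ℕ} (hp : 1 ≤ p) (V : Submodule ℂ (Matrix (Fin n) (Fin n) ℂ)) (hV : ∀ A ∈ V, A ^ p = 0)
    (B₁ B₂ : Matrix (Fin n) (Fin n) ℂ) (hB₁ : B₁ ∈ V) (hB₂ : B₂ ∈ V) (h₁ h₂ : ℤ)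
    (hl₁ : ∀ a b : Fin n, (b : ℤ) - a < h₁ → B₁ a b = 0) (hl₂ : ∀ a b : Fin n, (b : ℤ) - a < h₂ → B₂ a b = 0)
    (c₁ c₂ : ℂ) :
    (c₁ • Matrix.of (fun a b : Fin n => if (b : ℤ) - a = h₁ then B₁ a b else 0) +
      c₂ • Matrix.of (fun a b : Fin n => if (b : ℤ) - a = h₂ then B₂ a b else 0)) ^ p = 0 := by
  have key := pow_eq_zero_of_initialForms hp V hV ![B₁, B₂]
    (by intro i; fin_cases i <;> simp [hB₁, hB₂]) ![h₁, h₂]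
    (by intro i; fin_cases i <;> simp <;> assumption) ![c₁, c₂]
  simpa only [Fin.sum_univ_succ, Fin.sum_univ_zero, Matrix.cons_val_zero, Matrix.cons_val_succ, add_zero] using key

/-- Graded-limit lemma, three forms. -/
theorem forms3 {n p : ℕ} (hp : 1 ≤ p) (V : Submodule ℂ (Matrix (Fin n) (Fin n) ℂ)) (hV : ∀ A ∈ V, A ^ p = 0)
    (B₁ B₂ B₃ : Matrix (Fin n) (Fin n) ℂ) (hB₁ : B₁ ∈ V) (hB₂ : B₂ ∈ V) (hB₃ : B₃ ∈ V) (h₁ h₂ h₃ : ℤ)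
    (hl₁ : ∀ a b : Fin n, (b : ℤ) - a < h₁ → B₁ a b = 0) (hl₂ : ∀ a b : Fin n, (b : ℤ) - a < h₂ → B₂ a b = 0)
    (hl₃ : ∀ a b : Fin n, (b : ℤ) - a < h₃ → B₃ a b = 0) (c₁ c₂ c₃ : ℂ) :
    (c₁ • Matrix.of (fun a b : Fin n => if (b : ℤ) - a = h₁ then B₁ a b else 0) +
      (c₂ • Matrix.of (fun a b : Fin n => if (b : ℤ) - a = h₂ then B₂ a b else 0) +
        c₃ • Matrix.of (fun a b : Fin n => if (b : ℤ) - a = h₃ then B₃ a b else 0))) ^ p = 0 := by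
  have key := pow_eq_zero_of_initialForms hp V hV ![B₁, B₂, B₃]
    (by
      intro i
      refine Fin.cases ?_ (fun i => Fin.cases ?_ (fun i => Fin.cases ?_ (fun i => i.elim0) i) i) i <;>
        simp [hB₁, hB₂, hB₃])
    ![h₁, h₂, h₃]
    (by
      intro i
      refine Fin.cases ?_ (fun i => Fin.cases ?_ (fun i => Fin.cases ?_ (fun i => i.elim0) i) i) i <;>
        simp <;> assumption)
    ![c₁, c₂, c₃]
  simpa only [Fin.sum_univ_succ, Fin.sum_univ_zero, Matrix.cons_val_zero, Matrix.cons_val_succ, add_zero] using key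

/-! ## §2 Small `4 × 4` facts -/

/-- If column `0` of `B` vanishes below the diagonal then `(B⁴)₀₀ = B₀₀⁴`. -/
theorem pow4_00 (B : Matrix (Fin 4) (Fin 4) ℂ) (h1 : B 1 0 = 0) (h2 : B 2 0 = 0) (h3 : B 3 0 = 0) :
    (B ^ 4) 0 0 = (B 0 0) ^ 4 := by
  simp [pow_succ, Matrix.mul_apply, Fin.sum_univ_four, h1, h2, h3]

/-- If row `3` of `B` vanishes left of the diagonal then `(B⁴)₃₃ = B₃₃⁴`. -/
theorem pow4_33 (B : Matrix (Fin 4) (Fin 4) ℂ) (h1 : B 3 0 = 0) (h2 : B 3 1 = 0) (h3 : B 3 2 = 0) :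
    (B ^ 4) 3 3 = (B 3 3) ^ 4 := by
  simp [pow_succ, Matrix.mul_apply, Fin.sum_univ_four, h1, h2, h3]

/-- A strictly... an upper triangular `4 × 4` matrix with `B⁴ = 0` has zero diagonal. -/
theorem diag_zero_of_upper (B : Matrix (Fin 4) (Fin 4) ℂ) (h10 : B 1 0 = 0) (h20 : B 2 0 = 0) (h30 : B 3 0 = 0)
    (h21 : B 2 1 = 0) (h31 : B 3 1 = 0) (h32 : B 3 2 = 0) (hB : B ^ 4 = 0) :
    B 0 0 = 0 ∧ B 1 1 = 0 ∧ B 2 2 = 0 ∧ B 3 3 = 0 := by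
  have e0 : (B ^ 4) 0 0 = (B 0 0) ^ 4 := by
    simp [pow_succ, Matrix.mul_apply, Fin.sum_univ_four, h10, h20, h30]
  have e1 : (B ^ 4) 1 1 = (B 1 1) ^ 4 := by
    simp [pow_succ, Matrix.mul_apply, Fin.sum_univ_four, h10, h20, h30, h21, h31]
  have e2 : (B ^ 4) 2 2 = (B 2 2) ^ 4 := by
    simp [pow_succ, Matrix.mul_apply, Fin.sum_univ_four, h20, h30, h21, h31, h32]
  have e3 : (B ^ 4) 3 3 = (B 3 3) ^ 4 := by
    simp [pow_succ, Matrix.mul_apply, Fin.sum_univ_four, h30, h31, h32]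
  rw [hB] at e0 e1 e2 e3
  simp at e0 e1 e2 e3
  refine ⟨?_, ?_, ?_, ?_⟩
  · exact pow_eq_zero_iff (n := 4) (by norm_num) |>.mp e0.symm
  · exact pow_eq_zero_iff (n := 4) (by norm_num) |>.mp e1.symm
  · exact pow_eq_zero_iff (n := 4) (by norm_num) |>.mp e2.symm
  · exact pow_eq_zero_iff (n := 4) (by norm_num) |>.mp e3.symm

end Summit.ValiantsHypothesis.ValiantsHypothesis.Theorems.GrenetZeon.HeavyTopIotaFour

end
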